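import Summits.Ventures.HSemireg.UntwistCocycleTwistScalarTrace
import Literature.AlgebraicGeometry.Modules.ExtCohomologyComparison
import HarnessLib

/-!
# Venture HSemireg — route R1.0, untwisted reading: **the form-degree-`1` row of the Leibniz re-expansion `hσ`
# DISCHARGED on real carriers** — `σ₁^{E ⊗ M}(x ⊗ 1_M) = σ₁^E(x) + σ₀^E(x) ∪ [dlog g]`, so `{0,1}`-semiregularity of
# `E` iff of `E ⊗ M`, UNCONDITIONALLY (gs-g4; sequel of th-4 #13/#17 and of `UntwistCocycleTwistScalarTrace.lean`)

HONEST FRAMING. Module-level homological algebra on the tree's REAL carriers (Mathlib's `Abelian.Ext` in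
`X.Modules`; `σ_0 = sigmaZero`, `σ_1 = sigmaOne` of `HodgeTheory/AtiyahClassTraceReal.lean`; `sigmaHigher _ 0`,
`sigmaHigher _ 1` of `SemiregularityHigherSigma.lean`; th-4's constructed cocycle twist `- ⊗ M`, `M = lineBundle c`,
and `θ = (- ⊗ M)` on `Ext`). Nothing about any variety; no gerbe; nothing here says HC, HC_CM or HC_AV is proved.

WHAT CHANGES. In `UntwistCocycleTwistSigma.lean` (th-4 #13) the transport `IsISemiregular(E) ↔ IsISemiregular(E ⊗ M)`
holds GIVEN the triangular re-expansion `hσ : σ_q^{E⊗M}(θ x) = σ_q^E(x) + Σ_{j<q} u_{q,j}(σ_j^E(x))`; th-4 #17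
discharged the row `q = 0`. This file discharges the row `q = 1` for EVERY cocycle `c` and every finite locally free `E`:

* `sigmaOne_twist` — **`σ₁^{E⟨c⟩}(θ x) = σ₁^E(x) + υ(σ₀^E(x))`** with `υ = cupDlogClass c hE : H²(X, 𝒪_X) →+ H³(X, Ω¹)`
  the additive map "`∪ [dlog g]`" (through `Extⁱ(𝒪_X, –) ≅ Hⁱ(X, –)`, `Modules/ExtCohomologyComparison.lean`):
  `σ₁^{E⟨c⟩}(θx) = Tr_{Ω¹}(θx · At(E⟨c⟩))`, `At(E⟨c⟩) = θ(At E) · [λ] + [ν]` (`atiyahClass_twist`),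
  `Tr_{Ω¹}(θ(x · At E) · [λ]) = Tr_{Ω¹}(x · At E) = σ₁^E(x)` (`traceExtCoeff_twist_comp_dualHomTwist`) and
  `Tr_{Ω¹}(θx · [ν]) = Tr(θx) · [dlog g] = Tr(x) · [dlog g]` (`traceExtCoeff_twist_comp_classOf_twistScalarFamily`, th-4's
  `traceExt_twist`);
* `sigmaHigher_one_twist` — the same on the carriers `H³(X, ⋀¹Ω¹)`, `H²(X, Ω⁰)` of `sigmaHigher`
  (`hodgeCohomologyOneAddEquiv_sigmaHigher_one`, `hodgeCohomologyZeroAddEquiv_sigmaHigher_zero`);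
* `leibnizU` — the lower-triangular family `u_{q,j}` with `u_{1,0} = υ` (and `0` elsewhere), and
  **`isISemiregular_Iic_one_iff_twist : IsISemiregular hE (Iic 1) ↔ IsISemiregular (E⟨c⟩) (Iic 1)`** — th-4's
  `isISemiregular_iff_twist` at `I = {0, 1}` with its hypothesis `hσ` DISCHARGED (rows `q = 0, 1`); also
  `isOneSemiregular`-free corollary `isZeroOneSemiregular_iff_twist` on the carriers of `AtiyahClassTraceReal`.

What stays declared (route R1.0, untwisted reading): the rows `q ≥ 2` of `hσ` (they need the Leibniz rule for the
HIGHER Atiyah steps `at_j` on `E ⊗ Ωʲ` and the centrality of `[dlog g]` in Buchweitz–Flenner's algebra,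
`at_j · (1 ⊗ c) = ± (1 ⊗ c) · at_{j+1}`), and the gerbe side. At the `g = 4` anchor the `28`-dimensional target of `σ`
splits `6 + 16 + 6 = H²(𝒪) ⊕ H³(Ω¹) ⊕ H⁴(Ω²)`; the rows discharged here are the first two blocks (`22` of `28`).

## References

* R.-O. Buchweitz, H. Flenner, *A semiregularity map for modules and applications to deformations*, Compositio
  Math. 137 (2003), §1 (`σ_0`, `σ_1`), Def. 4.1, §5 (`I`-semiregular). [BuchweitzFlenner2003]
* M. F. Atiyah, *Complex analytic connections in fibre bundles*, Trans. AMS 85 (1957), Prop. 10, Prop. 12.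
  [Atiyah1957]
* R. Hartshorne, *Algebraic Geometry* (1977), III.6.3 (`Extⁱ(𝒪_X, G) ≅ Hⁱ(X, G)`). [Hartshorne1977]
-/

noncomputable section

open CategoryTheory CategoryTheory.Abelian AlgebraicGeometry Opposite TopologicalSpace Limits

namespace Summit.Ventures.HSemireg

namespace CocycleTwist

open Literature.AlgebraicGeometry.Modules Literature.AlgebraicGeometry.Motives
  Literature.AlgebraicGeometry.HodgeTheory Literature.AlgebraicGeometry.Modules.Cech Literature.Algebra.Homology

universe u

variable {S : Type u} [CommRing S] {X : Over (Spec (CommRingCat.of S))} [HasExt.{u + 1} X.left.Modules]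
  (c : UnitCocycle X.left) {E : X.left.Modules} (hE : IsFiniteLocallyFree E)

/-! ### The class `[dlog g] ∈ Ext¹(𝒪_X, Ω¹)` and the map `∪ [dlog g] : H²(X, 𝒪_X) → H³(X, Ω¹)` -/

/-- **The class `[dlog g] ∈ Ext¹(𝒪_X, Ω¹_{X/S})`** of the cocycle twist (on the cover `W_x` of
`UntwistCocycleTwistAtiyah`): the Čech class of the scalar cocycle `r ↦ r ω_{xy}`, `ω_{xy} = -g_{xy} d g_{yx}` — the
Atiyah class / first Chern class in Hodge cohomology of `M = lineBundle c`, up to sign. [cite: Atiyah1957, Prop. 12] -/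
def dlogClass : Ext.{u + 1} (unitModule X.left) (cotangentSheaf X) 1 :=
  classOf (exactAugmentation (leibnizCover c hE) _ (iSup_leibnizCover c hE)) (scalarFamily (twistDlogForms c hE))
    (dFamily_scalarFamily_twistDlogForms c hE)

/-- **`υ = ∪ [dlog g] : H²(X, 𝒪_X) →+ H³(X, Ω¹)`**: Yoneda product with `[dlog g]` on `Ext²(𝒪_X, 𝒪_X)`, read through
the comparison isomorphisms `Extⁱ(𝒪_X, G) ≅ Hⁱ(X, G)` (Hartshorne III.6.3, tree `extToCohomology_bijective`).
[cite: Hartshorne1977, III Prop. 6.3 (c)] -/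
def cupDlogClass : structureSheafCohomology X.left 2 →+ hodgeCohomologyOne X 3 :=
  (extToCohomology (cotangentSheaf X) 3).comp
    (((dlogClass c hE).postcomp (unitModule X.left) (rfl : 2 + 1 = 3)).comp
      (AddEquiv.ofBijective (extToCohomology.{u + 1} (unitModule X.left) 2)
        (extToCohomology_bijective (unitModule X.left) 2)).symm.toAddMonoidHom)

/-- `υ` on the image of `Ext²(𝒪_X, 𝒪_X)`: `υ(ext→H (t)) = ext→H (t · [dlog g])`. [folklore] -/
theorem cupDlogClass_extToCohomology (t : Ext.{u + 1} (unitModule X.left) (unitModule X.left) 2) :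
    cupDlogClass c hE (extToCohomology (unitModule X.left) 2 t) =
      extToCohomology (cotangentSheaf X) 3 (t.comp (dlogClass c hE) (rfl : 2 + 1 = 3)) := by
  have h : (AddEquiv.ofBijective (extToCohomology.{u + 1} (unitModule X.left) 2)
      (extToCohomology_bijective (unitModule X.left) 2)).symm (extToCohomology (unitModule X.left) 2 t) = t :=
    (AddEquiv.ofBijective _ (extToCohomology_bijective (unitModule X.left) 2)).symm_apply_apply t
  change extToCohomology (cotangentSheaf X) 3 (((AddEquiv.ofBijective (extToCohomology.{u + 1} (unitModule X.left) 2)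
      (extToCohomology_bijective (unitModule X.left) 2)).symm (extToCohomology (unitModule X.left) 2 t)).comp
      (dlogClass c hE) (rfl : 2 + 1 = 3)) = _
  rw [h]

/-! ### The row `q = 1`: `σ₁^{E⟨c⟩}(θ x) = σ₁^E(x) + σ₀^E(x) ∪ [dlog g]` -/

/-- **`Tr_{Ω¹}(θx · At(E⟨c⟩)) = Tr_{Ω¹}(x · At(E)) + Tr(x) · [dlog g]`** in `Ext³(𝒪_X, Ω¹)` (the Leibniz rule
`atiyahClass_twist`, the comparison `traceExtCoeff_twist_comp_dualHomTwist`, the scalar-class trace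
`traceExtCoeff_twist_comp_classOf_twistScalarFamily` and th-4's `traceExt_twist`).
[cite: BuchweitzFlenner2003, Def. 4.1; Atiyah1957, Prop. 10 and Prop. 12] -/
theorem traceExtCoeff_twist_comp_atiyahClass (x : Ext.{u + 1} E E 2) :
    traceExtCoeff (isFiniteLocallyFree_twist c hE) (cotangentSheaf X) 3
        (((twistEquivalence X.left c).functor.mapExtAddHom E E 2 x).comp (atiyahClass (twist c E))
          (rfl : 2 + 1 = 3)) =
      traceExtCoeff hE (cotangentSheaf X) 3 (x.comp (atiyahClass E) (rfl : 2 + 1 = 3)) +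
        (traceExt hE 2 x).comp (dlogClass c hE) (rfl : 2 + 1 = 3) := by
  have hmain : ((twistEquivalence X.left c).functor.mapExtAddHom E E 2 x).comp (atiyahClassTwistMain c (E := E))
      (rfl : 2 + 1 = 3) =
      ((twistEquivalence X.left c).functor.mapExtAddHom E (twistCotangent E) 3
        (x.comp (atiyahClass E) (rfl : 2 + 1 = 3))).comp (Ext.mk₀ (dualHomTwistObj c E (cotangentSheaf X)))
        (add_zero 3) := by
    rw [atiyahClassTwistMain_def, Functor.mapExtAddHom_apply, Functor.mapExtAddHom_apply, Functor.mapExtAddHom_apply,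
      Ext.mapExactFunctor_comp]
    exact (Ext.comp_assoc_of_third_deg_zero _ _ _ _).symm
  have hsum : traceExtCoeff (isFiniteLocallyFree_twist c hE) (cotangentSheaf X) 3
      (((twistEquivalence X.left c).functor.mapExtAddHom E E 2 x).comp
        (atiyahClassTwistMain c (E := E) +
          classOf (exactAugmentation (leibnizCover c hE) _ (iSup_leibnizCover c hE)) (twistScalarFamily c hE)
            (dFamily_twistScalarFamily c hE)) (rfl : 2 + 1 = 3)) =
      traceExtCoeff (isFiniteLocallyFree_twist c hE) (cotangentSheaf X) 3
          (((twistEquivalence X.left c).functor.mapExtAddHom E E 2 x).comp (atiyahClassTwistMain c (E := E))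
            (rfl : 2 + 1 = 3)) +
        traceExtCoeff (isFiniteLocallyFree_twist c hE) (cotangentSheaf X) 3
          (((twistEquivalence X.left c).functor.mapExtAddHom E E 2 x).comp
            (classOf (exactAugmentation (leibnizCover c hE) _ (iSup_leibnizCover c hE)) (twistScalarFamily c hE)
              (dFamily_twistScalarFamily c hE)) (rfl : 2 + 1 = 3)) :=
    (congrArg (traceExtCoeff (isFiniteLocallyFree_twist c hE) (cotangentSheaf X) 3) (Ext.comp_add _ _ _ _)).trans
      (map_add _ _ _)
  rw [atiyahClass_twist c hE, hsum, hmain, traceExtCoeff_twist_comp_dualHomTwist, dlogClass, ← traceExt_twist c hE 2 x]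
  exact congrArg _ (traceExtCoeff_twist_comp_classOf_twistScalarFamily c hE
    ((twistEquivalence X.left c).functor.mapExtAddHom E E 2 x))

/-- **The row `q = 1` of `hσ` on the carriers of `AtiyahClassTraceReal`:
`σ₁^{E⟨c⟩}(θ x) = σ₁^E(x) + υ(σ₀^E(x))`**, `υ = ∪ [dlog g]`, for every cocycle `c`, every finite locally free `E` and
every `x ∈ Ext²(E, E)`. [cite: BuchweitzFlenner2003, Def. 4.1; Atiyah1957, Prop. 10 and Prop. 12] -/
theorem sigmaOne_twist (x : Ext.{u + 1} E E 2) :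
    sigmaOne (isFiniteLocallyFree_twist c hE) ((twistEquivalence X.left c).functor.mapExtAddHom E E 2 x) =
      sigmaOne hE x + cupDlogClass c hE (sigmaZero hE x) := by
  rw [sigmaOne_apply, sigmaOne_apply, sigmaZero_apply, cupDlogClass_extToCohomology]
  change extToCohomology (cotangentSheaf X) 3 _ =
    extToCohomology (cotangentSheaf X) 3 _ + extToCohomology (cotangentSheaf X) 3 _
  rw [← map_add]
  exact congrArg _ (traceExtCoeff_twist_comp_atiyahClass c hE x)

/-! ### The same on the carriers of `sigmaHigher`; the lower-triangular family `u` -/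

/-- **`u_{1,0} : H²(X, Ω⁰) →+ H³(X, ⋀¹ Ω¹)`**: `υ = ∪ [dlog g]` transported to the carriers of `sigmaHigher`
(`H²(X, Ω⁰) ≅ H²(X, 𝒪_X)`, `H³(X, ⋀¹Ω¹) ≅ H³(X, Ω¹)`). [folklore] -/
def leibnizUOne : hodgeCohomology X 0 (0 + 2) →+ hodgeCohomology X 1 (1 + 2) :=
  ((hodgeCohomologyOneAddEquiv X 3).symm.toAddMonoidHom.comp (cupDlogClass c hE)).comp
    (hodgeCohomologyZeroAddEquiv X 2).toAddMonoidHom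

/-- **The lower-triangular family `u_{q,j}` of the Leibniz re-expansion**, as far as the tree proves it:
`u_{1,0} = ∪ [dlog g]`, all other entries `0` (the rows `q ≥ 2` are not claimed). [folklore] -/
def leibnizU : ∀ q j : ℕ, hodgeCohomology X j (j + 2) →+ hodgeCohomology X q (q + 2)
  | 1, 0 => leibnizUOne c hE
  | _, _ => 0

/-- **The row `q = 1` of `hσ` on the carriers of `sigmaHigher`**:
`σ₁^{E⟨c⟩}(θ x) = σ₁^E(x) + u_{1,0}(σ₀^E(x))`. [cite: BuchweitzFlenner2003, Def. 4.1; Atiyah1957, Prop. 10 and Prop. 12] -/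
theorem sigmaHigher_one_twist (x : Ext.{u + 1} E E 2) :
    sigmaHigher (isFiniteLocallyFree_twist c hE) 1 ((twistEquivalence X.left c).functor.mapExtAddHom E E 2 x) =
      sigmaHigher hE 1 x + leibnizUOne c hE (sigmaHigher hE 0 x) := by
  apply (hodgeCohomologyOneAddEquiv X 3).injective
  rw [hodgeCohomologyOneAddEquiv_sigmaHigher_one, map_add, hodgeCohomologyOneAddEquiv_sigmaHigher_one, sigmaOne_twist,
    leibnizUOne, AddMonoidHom.comp_apply, AddMonoidHom.comp_apply, AddEquiv.toAddMonoidHom_eq_coe,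
    AddEquiv.toAddMonoidHom_eq_coe, AddMonoidHom.coe_coe, AddMonoidHom.coe_coe, AddEquiv.apply_symm_apply,
    hodgeCohomologyZeroAddEquiv_sigmaHigher_zero]

/-- **Rows `q = 0, 1` of the Leibniz re-expansion `hσ`** in the shape of th-4's `isISemiregular_iff_twist`: for
`q ≤ 1`, `σ_q^{E⟨c⟩}(θ x) = σ_q^E(x) + Σ_{j<q} u_{q,j}(σ_j^E(x))`. [cite: BuchweitzFlenner2003, §5; Atiyah1957, Prop. 10 and Prop. 12] -/
theorem sigmaHigher_twist_of_le_one (q : ℕ) (hq : q ∈ Set.Iic 1) (x : Ext.{u + 1} E E 2) :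
    sigmaHigher (isFiniteLocallyFree_twist c hE) q ((twistEquivalence X.left c).functor.mapExtAddHom E E 2 x) =
      sigmaHigher hE q x + ∑ j ∈ Finset.range q, leibnizU c hE q j (sigmaHigher hE j x) := by
  rcases Nat.le_one_iff_eq_zero_or_eq_one.mp (Set.mem_Iic.mp hq) with rfl | rfl
  · rw [Finset.range_zero, Finset.sum_empty, add_zero]
    exact sigmaHigher_zero_twist c hE x
  · rw [Finset.sum_range_one]
    exact sigmaHigher_one_twist c hE x

/-- **`{0, 1}`-semiregularity (joint injectivity of `(σ_0, σ_1) : Ext²(E, E) → H²(X, Ω⁰) ⊕ H³(X, ⋀¹Ω¹)`) of `E` iff of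
`E ⊗ M`** — th-4's `isISemiregular_iff_twist` (file #13 §2) at `I = Iic 1` with its binder `hσ` DISCHARGED: the rows
`q = 0` (th-4 #17) and `q = 1` (this file) of the Leibniz re-expansion hold on real carriers for every cocycle `c`.
[cite: BuchweitzFlenner2003, §5 (I-semiregular)] -/
theorem isISemiregular_Iic_one_iff_twist :
    IsISemiregular.{u + 1} hE (Set.Iic 1) ↔ IsISemiregular.{u + 1} (isFiniteLocallyFree_twist c hE) (Set.Iic 1) :=
  isISemiregular_iff_twist c hE (leibnizU c hE) (isLowerSet_Iic 1) fun q hq x => sigmaHigher_twist_of_le_one c hE q hq x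

/-- **`{0,1}`-semiregularity on the carriers of `AtiyahClassTraceReal` (`σ_0 = Tr`, `σ_1 = Tr(At ∘ –)`) of `E` iff
of `E ⊗ M`**: `(σ₀, σ₁)^{E⟨c⟩} ∘ θ = (σ₀^E, σ₁^E + υ σ₀^E)` with `θ` bijective, a unitriangular re-expansion.
[cite: BuchweitzFlenner2003, §1 and §5] -/
theorem isZeroOneSemiregular_iff_twist :
    IsZeroOneSemiregular hE ↔ IsZeroOneSemiregular (isFiniteLocallyFree_twist c hE) := by
  rw [isZeroOneSemiregular_iff, isZeroOneSemiregular_iff]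
  have hθ := mapExtAddHom_twist_bijective c E E 2
  constructor
  · intro h x' h0 h1
    obtain ⟨x, rfl⟩ := hθ.2 x'
    rw [sigmaZero_twist c hE x] at h0
    rw [sigmaOne_twist c hE x, h0, map_zero, add_zero] at h1
    rw [h x h0 h1, map_zero]
    rfl
  · intro h x h0 h1
    have h0' : sigmaZero (isFiniteLocallyFree_twist c hE) ((twistEquivalence X.left c).functor.mapExtAddHom E E 2 x) = 0 := by
      rw [sigmaZero_twist c hE x, h0]
    have h1' : sigmaOne (isFiniteLocallyFree_twist c hE) ((twistEquivalence X.left c).functor.mapExtAddHom E E 2 x) = 0 := by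
      rw [sigmaOne_twist c hE x, h0, h1, map_zero, add_zero]
    exact hθ.1 ((h _ h0' h1').trans (map_zero _).symm)

end CocycleTwist

end Summit.Ventures.HSemireg

end
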